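import Summits.RiemannHypothesis.RiemannHypothesis.Theorems.LiDirichletEchoImContour
import Summits.RiemannHypothesis.RiemannHypothesis.Theorems.LiDirichletEchoLiGammaShiftChar
import HarnessLib

/-!
# RiemannHypothesis / LiDirichletEcho — complex companion, part 2: the antisymmetric gamma edge IS the ODD smooth mean
# (RH-FREE, GRH-FREE)

RH-FREE · GRH-FREE [rh-li-eng g5].  Towards `LiTheory.LiZeroWindowEchoDirichletComplex` (imaginary channel).  For every character
`χ` mod `q` and `c ≥ 1` there are `N`, `C = C(q)` such that for `n ≥ N`, `√n ≤ T₁ < T₂ ≤ c√n + 1`,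

  `|charGammaEdgeIm χ n T₁ T₂ − charSmoothOddWindow χ n T₁ T₂| ≤ C log n`,  `charSmoothOddWindow = (2/π)∫ sin(nθ(t)) g_χ(t) dt`.

Proof = K4χ (`Theorems/LiDirichletEchoLiGammaShiftChar.lean`) with the antisymmetrised weight: Cauchy on `[1/2, 3/2] × [T₁, T₂]`
for `G⁻(w) = (½ log(q/π) + ½ ψ((w + a)/2)) k⁻_n(w)`; on the critical line `k⁻_n(½ + it) = e^{inθ} − e^{−inθ} = 2i sin(nθ(t))`, so
`Im G⁻(½ + it) = 2 sin(nθ(t)) · charGammaDensity χ t` EXACTLY; the connectors cost `≤ (½ log(T + 4) + 4 + ½|log(q/π)|)(1 + e)`.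
The odd smooth mean is the same for `χ` and `χ̄` (it depends only on `q` and the parity), which is why the imaginary channel of
the complex law carries NO smooth term.  Nothing here bears on the truth of RH or GRH.
-/

noncomputable section

-- D-0017: `Summit.<S>.<S>.…` is the designed namespace of a single-problem summit.
set_option linter.dupNamespace false

open Complex MeasureTheory intervalIntegral Set
open scoped Real Interval ComplexConjugate

namespace Summit.RiemannHypothesis.RiemannHypothesis.Theorems.LiTheory

open Literature.NumberTheory.LFunctions

variable {q : ℕ} [NeZero q]

/-- The ODD smooth mean of the window: `(2/π) ∫_{T₁}^{T₂} sin(nθ(t)) g_χ(t) dt`. -/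
def charSmoothOddWindow (χ : DirichletCharacter ℂ q) (n : ℕ) (T₁ T₂ : ℝ) : ℝ :=
  2 / Real.pi * ∫ t in T₁..T₂, Real.sin (n * liZeroAngle t) * charGammaDensity χ t

namespace ImGammaShiftChar

open GammaShift GammaShiftChar

/-- The antisymmetric gamma-edge integrand `G⁻(w) = (½ log(q/π) + ½ ψ((w + a)/2)) k⁻_n(w)`. -/
def gammaIntegrandIm (χ : DirichletCharacter ℂ q) (n : ℕ) (w : ℂ) : ℂ :=
  ((Real.log (q / Real.pi) : ℂ) / 2 + 1 / 2 * Complex.digamma ((w + (charParity χ : ℂ)) / 2)) * liAntiWeight n w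

omit [NeZero q] in
/-- `G⁻` is differentiable at every `w` with `Re w > 0`, `Im w ≠ 0`. -/
theorem differentiableAt_gammaIntegrandIm (χ : DirichletCharacter ℂ q) (n : ℕ) {w : ℂ} (hre : 0 < w.re)
    (him : w.im ≠ 0) : DifferentiableAt ℂ (gammaIntegrandIm χ n) w := by
  have hw0 : w ≠ 0 := fun h ↦ him (by simp [h])
  have hw1 : (1 : ℂ) - w ≠ 0 := by
    intro h; apply him
    have := congrArg Complex.im h; simpa using this.symm
  have ha : (0 : ℝ) ≤ charParity χ := Nat.cast_nonneg _
  have hψ : DifferentiableAt ℂ (fun z : ℂ ↦ Complex.digamma ((z + (charParity χ : ℂ)) / 2)) w := by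
    have hmem : (w + (charParity χ : ℂ)) / 2 ∈ {s : ℂ | 0 < s.re} := by
      simp only [mem_setOf_eq, Complex.div_ofNat_re, Complex.add_re, Complex.natCast_re]
      linarith
    have hd := Literature.Analysis.SpecialFunctions.Complex.differentiableOn_digamma.differentiableAt
      ((isOpen_lt continuous_const Complex.continuous_re).mem_nhds hmem)
    exact hd.comp w ((differentiableAt_id.add_const _).div_const 2)
  have hk : DifferentiableAt ℂ (liAntiWeight n) w := by
    unfold liAntiWeight
    refine (differentiableAt_liWeight n hw0).sub ?_
    exact (differentiableAt_liWeight n hw1).comp w ((differentiableAt_const _).sub differentiableAt_id)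
  unfold gammaIntegrandIm
  exact ((differentiableAt_const _).add ((differentiableAt_const _).mul hψ)).mul hk

omit [NeZero q] in
/-- `G⁻` is differentiable on every rectangle `[a, b] × [T₁, T₂]` with `a > 0`, `T₁ > 0`. -/
theorem differentiableOn_gammaIntegrandIm (χ : DirichletCharacter ℂ q) (n : ℕ) {a b T₁ T₂ : ℝ} (ha : 0 < a)
    (hab : a ≤ b) (hT₁ : 0 < T₁) (hT : T₁ ≤ T₂) :
    DifferentiableOn ℂ (gammaIntegrandIm χ n) ([[a, b]] ×ℂ [[T₁, T₂]]) := by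
  intro w hw
  rw [uIcc_of_le hab, uIcc_of_le hT, Complex.mem_reProdIm] at hw
  exact (differentiableAt_gammaIntegrandIm χ n (ha.trans_le hw.1.1) (by linarith [hw.2.1])).differentiableWithinAt

/-! ### The critical line: `k⁻_n(½ + it) = 2i sin(nθ(t))` -/

/-- `k⁻_n(½ + it) = 2i sin(nθ(t))` (`t ≠ 0`). -/
theorem liAntiWeight_half_line (n : ℕ) {t : ℝ} (ht : t ≠ 0) :
    liAntiWeight n (1 / 2 + t * I) = ((2 * Real.sin (n * liZeroAngle t) : ℝ) : ℂ) * I := by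
  set s : ℂ := 1 / 2 + t * I with hs
  have hre : s.re = 1 / 2 := by simp [hs]
  have hsim : s.im = t := by simp [hs]
  have h1 : 1 - 1 / s = Complex.exp (liZeroAngle t * I) := by
    rw [← hsim]; exact BoxSplit.one_sub_inv_eq_exp hre (by rwa [hsim])
  have hconj : 1 - s = conj s := by
    apply Complex.ext <;> simp [hs] ; norm_num
  have h2 : 1 - 1 / (1 - s) = Complex.exp (-(liZeroAngle t * I)) := by
    rw [hconj, show (1 : ℂ) - 1 / conj s = conj (1 - 1 / s) by simp [map_sub], h1, ← Complex.exp_conj]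
    congr 1
    simp [Complex.conj_ofReal]
  unfold liAntiWeight liWeight
  rw [h1, h2, ← Complex.exp_nat_mul, ← Complex.exp_nat_mul]
  push_cast
  set φ : ℂ := (n : ℂ) * (liZeroAngle t : ℂ) with hφ
  have e1 : (n : ℂ) * ((liZeroAngle t : ℂ) * I) = φ * I := by rw [hφ]; ring
  have e2 : (n : ℂ) * -((liZeroAngle t : ℂ) * I) = -φ * I := by rw [hφ]; ring
  rw [e1, e2, Complex.sin]
  have hI : I * I = -1 := Complex.I_mul_I
  linear_combination (Complex.exp (φ * I) - Complex.exp (-φ * I)) * hI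

omit [NeZero q] in
/-- On the critical line the antisymmetric gamma integrand's IMAGINARY part is the odd smooth density:
`Im G⁻(½ + it) = 2 sin(nθ(t)) · charGammaDensity χ t` (`t ≠ 0`). -/
theorem im_gammaIntegrandIm_half_line (χ : DirichletCharacter ℂ q) (n : ℕ) {t : ℝ} (ht : t ≠ 0) :
    (gammaIntegrandIm χ n (1 / 2 + t * I)).im = 2 * Real.sin (n * liZeroAngle t) * charGammaDensity χ t := by
  unfold gammaIntegrandIm
  rw [liAntiWeight_half_line n ht]
  have harg : ((1 : ℂ) / 2 + t * I + (charParity χ : ℂ)) / 2 = (1 / 2 + (charParity χ : ℂ) + (t : ℂ) * I) / 2 := by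
    ring
  rw [harg]
  unfold charGammaDensity
  rw [Complex.digamma_def]
  set A : ℂ := (Real.log (q / Real.pi) : ℂ) / 2
      + 1 / 2 * logDeriv Complex.Gamma ((1 / 2 + (charParity χ : ℂ) + (t : ℂ) * I) / 2) with hA
  have hAre : A.re = Real.log (q / Real.pi) / 2
      + (logDeriv Complex.Gamma ((1 / 2 + (charParity χ : ℂ) + (t : ℂ) * I) / 2)).re / 2 := by
    rw [hA]; simp [Complex.add_re, Complex.mul_re]; ring
  set r : ℝ := 2 * Real.sin (n * liZeroAngle t) with hr
  have him : (A * ((r : ℂ) * I)).im = A.re * r := by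
    rw [Complex.mul_im, Complex.mul_I_im, Complex.mul_I_re, Complex.ofReal_re, Complex.ofReal_im, neg_zero, mul_zero,
      add_zero]
  rw [him, hAre, hr]
  ring

/-! ### The horizontal connectors -/

omit [NeZero q] in
/-- On a horizontal connector `x ∈ [1/2, 3/2]`, `T ≥ 1`, `T² ≥ n`:
`‖G⁻(x + iT)‖ ≤ (log(T + 4)/2 + 4 + |log(q/π)|/2)(1 + e)`. -/
theorem norm_gammaIntegrandIm_le (χ : DirichletCharacter ℂ q) (n : ℕ) {x T : ℝ} (hx : x ∈ Icc (1 / 2 : ℝ) (3 / 2))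
    (hT : 1 ≤ T) (hn : (n : ℝ) ≤ T ^ 2) :
    ‖gammaIntegrandIm χ n (x + T * I)‖ ≤
      (Real.log (T + 4) / 2 + 4 + |Real.log (q / Real.pi)| / 2) * (1 + Real.exp 1) := by
  -- the digamma factor is bounded exactly as in `GammaShiftChar.norm_gammaIntegrand_le`; we reuse that bound through the
  -- identity `‖G⁻‖ · ‖k_n‖ … ` — simpler: repeat the two factor bounds.
  have hT0 : 0 < T := by linarith
  have ha0 : (0 : ℝ) ≤ charParity χ := Nat.cast_nonneg _
  have ha1 : (charParity χ : ℝ) ≤ 1 := by exact_mod_cast charParity_le_one χ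
  set w : ℂ := x + T * I with hw
  set v : ℂ := (w + (charParity χ : ℂ)) / 2 with hv
  have hψ : ‖(Real.log (q / Real.pi) : ℂ) / 2 + 1 / 2 * Complex.digamma v‖
      ≤ Real.log (T + 4) / 2 + 4 + |Real.log (q / Real.pi)| / 2 := by
    have hvre' : v.re = (x + (charParity χ : ℝ)) / 2 := by rw [hv, hw]; simp
    have hvim' : v.im = T / 2 := by rw [hv, hw]; simp
    have hvre : 0 < v.re := by rw [hvre']; linarith [hx.1]
    have hvim : 1 / 2 ≤ |v.im| := by rw [hvim', abs_of_pos (by positivity)]; linarith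
    have hvn : ‖v‖ ≤ T + 3 := by
      rw [hv, norm_div, Complex.norm_two]
      have : ‖w + (charParity χ : ℂ)‖ ≤ |x| + |T| + charParity χ := by
        calc ‖w + (charParity χ : ℂ)‖ ≤ ‖w‖ + ‖(charParity χ : ℂ)‖ := norm_add_le _ _
          _ ≤ (‖(x : ℂ)‖ + ‖(T : ℂ) * I‖) + ‖(charParity χ : ℂ)‖ := by gcongr; exact norm_add_le _ _
          _ = |x| + |T| + charParity χ := by simp
      rw [abs_of_pos hT0, abs_of_pos (by linarith [hx.1])] at this
      linarith [hx.2]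
    have hd := norm_digamma_le_log_height hvre hvim hvn
    have hlog : ‖(Real.log (q / Real.pi) : ℂ) / 2‖ = |Real.log (q / Real.pi)| / 2 := by
      rw [norm_div, Complex.norm_real, Complex.norm_two, Real.norm_eq_abs]
    calc ‖(Real.log (q / Real.pi) : ℂ) / 2 + 1 / 2 * Complex.digamma v‖
        ≤ ‖(Real.log (q / Real.pi) : ℂ) / 2‖ + ‖(1 / 2 : ℂ) * Complex.digamma v‖ := norm_add_le _ _
      _ ≤ |Real.log (q / Real.pi)| / 2 + 1 / 2 * (Real.log (T + 4) + 8) := by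
          rw [hlog, norm_mul]
          gcongr
          simp
      _ = Real.log (T + 4) / 2 + 4 + |Real.log (q / Real.pi)| / 2 := by ring
  have hk : ‖liAntiWeight n w‖ ≤ 1 + Real.exp 1 := by
    unfold liAntiWeight
    refine (norm_sub_le _ _).trans (add_le_add ?_ (norm_liWeight_one_sub_le n hx.2 hT0 hn))
    unfold liWeight
    rw [norm_pow]
    refine pow_le_one₀ (norm_nonneg _) ?_
    have hw0 : w ≠ 0 := fun h0 ↦ by have := congrArg Complex.im h0; simp [hw] at this; exact hT0.ne' this
    rw [show (1 : ℂ) - 1 / w = (w - 1) / w by field_simp, norm_div, div_le_one (norm_pos_iff.2 hw0)]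
    have h1 : ‖w - 1‖ ^ 2 ≤ ‖w‖ ^ 2 := by
      rw [Complex.sq_norm, Complex.sq_norm, Complex.normSq_apply, Complex.normSq_apply]
      simp [hw]
      nlinarith [hx.1]
    exact (pow_le_pow_iff_left₀ (norm_nonneg _) (norm_nonneg _) two_ne_zero).1 h1
  unfold gammaIntegrandIm
  rw [norm_mul]
  have hlog0 : 0 ≤ Real.log (T + 4) := Real.log_nonneg (by linarith)
  have habs0 : 0 ≤ |Real.log (q / Real.pi)| := abs_nonneg _
  exact mul_le_mul hψ hk (norm_nonneg _) (by linarith)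

omit [NeZero q] in
/-- A horizontal connector costs `≤ (log(T + 4)/2 + 4 + |log(q/π)|/2)(1 + e)` (`T ≥ 1`, `T² ≥ n`). -/
theorem norm_integral_connector_le (χ : DirichletCharacter ℂ q) (n : ℕ) {T : ℝ} (hT : 1 ≤ T) (hn : (n : ℝ) ≤ T ^ 2) :
    ‖∫ x in (1 / 2 : ℝ)..(3 / 2 : ℝ), gammaIntegrandIm χ n (x + T * I)‖ ≤
      (Real.log (T + 4) / 2 + 4 + |Real.log (q / Real.pi)| / 2) * (1 + Real.exp 1) := by
  have hpt : ∀ x ∈ Ι (1 / 2 : ℝ) (3 / 2), ‖gammaIntegrandIm χ n (x + T * I)‖ ≤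
      (Real.log (T + 4) / 2 + 4 + |Real.log (q / Real.pi)| / 2) * (1 + Real.exp 1) := by
    intro x hx
    rw [uIoc_of_le (by norm_num)] at hx
    exact norm_gammaIntegrandIm_le χ n ⟨hx.1.le, hx.2⟩ hT hn
  have h := intervalIntegral.norm_integral_le_of_norm_le_const hpt
  have hlen : |(3 / 2 : ℝ) - 1 / 2| = 1 := by norm_num
  rw [hlen, mul_one] at h
  exact h

/-! ### Cauchy -/

omit [NeZero q] in
/-- For `0 < T₁ ≤ T₂`: `charGammaEdgeIm χ n T₁ T₂ − charSmoothOddWindow χ n T₁ T₂ = −(1/π) Re(∫_top − ∫_bot)`. -/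
theorem gammaEdgeIm_sub_smoothOdd_eq (χ : DirichletCharacter ℂ q) (n : ℕ) {T₁ T₂ : ℝ} (hT₁ : 0 < T₁) (hT : T₁ ≤ T₂) :
    charGammaEdgeIm χ n T₁ T₂ - charSmoothOddWindow χ n T₁ T₂ =
      -(1 / Real.pi) * ((∫ x in (1 / 2 : ℝ)..(3 / 2 : ℝ), gammaIntegrandIm χ n (x + T₂ * I)) -
        ∫ x in (1 / 2 : ℝ)..(3 / 2 : ℝ), gammaIntegrandIm χ n (x + T₁ * I)).re := by
  have hC := Complex.integral_boundary_rect_eq_zero_of_differentiableOn (gammaIntegrandIm χ n) (1 / 2 + T₁ * I)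
    (3 / 2 + T₂ * I) (by
      have h1 : ((1 : ℂ) / 2 + T₁ * I).re = 1 / 2 := by simp
      have h2 : ((3 : ℂ) / 2 + T₂ * I).re = 3 / 2 := by simp
      have h3 : ((1 : ℂ) / 2 + T₁ * I).im = T₁ := by simp
      have h4 : ((3 : ℂ) / 2 + T₂ * I).im = T₂ := by simp
      rw [h1, h2, h3, h4]
      exact differentiableOn_gammaIntegrandIm χ n (by norm_num) (by norm_num) hT₁ hT)
  simp only [Complex.add_re, Complex.add_im, Complex.div_ofNat_re, Complex.one_re, Complex.mul_re, Complex.ofReal_re,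
    Complex.I_re, Complex.ofReal_im, Complex.I_im, Complex.div_ofNat_im, Complex.one_im, Complex.mul_im,
    Complex.re_ofNat, Complex.im_ofNat] at hC
  norm_num at hC
  set IR := ∫ y in T₁..T₂, gammaIntegrandIm χ n (3 / 2 + y * I) with hIR
  set IL := ∫ y in T₁..T₂, gammaIntegrandIm χ n (1 / 2 + y * I) with hIL
  set Itop := ∫ x in (1 / 2 : ℝ)..(3 / 2 : ℝ), gammaIntegrandIm χ n (x + T₂ * I) with hItop
  set Ibot := ∫ x in (1 / 2 : ℝ)..(3 / 2 : ℝ), gammaIntegrandIm χ n (x + T₁ * I) with hIbot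
  have hRL : IR = IL - I * (Itop - Ibot) := by
    have hI : I * I = -1 := Complex.I_mul_I
    linear_combination (-I) * hC + (IR - IL) * hI
  have hedge : charGammaEdgeIm χ n T₁ T₂ = 1 / Real.pi * IR.im := by
    rw [hIR]; rfl
  have hleft : IL.im = ∫ y in T₁..T₂, 2 * Real.sin (n * liZeroAngle y) * charGammaDensity χ y := by
    have hcont : ContinuousOn (fun y : ℝ ↦ gammaIntegrandIm χ n (1 / 2 + y * I)) (uIcc T₁ T₂) := by
      refine continuousOn_of_forall_continuousAt fun y hy ↦ ?_
      rw [uIcc_of_le hT] at hy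
      have hy0 : 0 < y := hT₁.trans_le hy.1
      have hd := differentiableAt_gammaIntegrandIm χ n (w := 1 / 2 + y * I) (by simp) (by simp; exact hy0.ne')
      have hc2 : Continuous fun y : ℝ ↦ (1 : ℂ) / 2 + y * I := by fun_prop
      show ContinuousAt ((gammaIntegrandIm χ n) ∘ fun y : ℝ ↦ (1 : ℂ) / 2 + y * I) y
      exact ContinuousAt.comp hd.continuousAt hc2.continuousAt
    have hi : IntervalIntegrable (fun y : ℝ ↦ gammaIntegrandIm χ n (1 / 2 + y * I)) volume T₁ T₂ :=
      hcont.intervalIntegrable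
    have hcomm := ContinuousLinearMap.intervalIntegral_comp_comm Complex.imCLM hi
    simp only [Complex.imCLM_apply] at hcomm
    rw [hIL, ← hcomm]
    refine intervalIntegral.integral_congr fun y hy ↦ ?_
    rw [uIcc_of_le hT] at hy
    exact im_gammaIntegrandIm_half_line χ n (hT₁.trans_le hy.1).ne'
  have hsmooth : charSmoothOddWindow χ n T₁ T₂ = 1 / Real.pi * IL.im := by
    unfold charSmoothOddWindow
    rw [hleft, ← intervalIntegral.integral_const_mul, ← intervalIntegral.integral_const_mul]
    refine intervalIntegral.integral_congr fun y _ ↦ ?_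
    ring
  rw [hedge, hsmooth, hRL]
  simp only [Complex.sub_im, Complex.mul_im, Complex.I_re, Complex.I_im, zero_mul, one_mul, zero_add, Complex.sub_re]
  ring

end ImGammaShiftChar

omit [NeZero q] in
open ImGammaShiftChar in
/-- **The antisymmetric gamma edge is the odd smooth mean, up to `O(log n)`** (RH-FREE, GRH-FREE): for every character
`χ` mod `q` and `c ≥ 1` there are `N`, `C` with `|charGammaEdgeIm χ n T₁ T₂ − charSmoothOddWindow χ n T₁ T₂| ≤ C log n`
whenever `n ≥ N`, `√n ≤ T₁ < T₂ ≤ c√n + 1`. -/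
theorem charGammaEdgeIm_bound (χ : DirichletCharacter ℂ q) :
    ∀ c : ℝ, 1 ≤ c → ∃ N : ℕ, ∃ C : ℝ, ∀ n : ℕ, N ≤ n → ∀ T₁ T₂ : ℝ, Real.sqrt n ≤ T₁ → T₁ < T₂ →
      T₂ ≤ c * Real.sqrt n + 1 → |charGammaEdgeIm χ n T₁ T₂ - charSmoothOddWindow χ n T₁ T₂| ≤ C * Real.log n := by
  -- as `liGammaShiftChar_bound`
  intro c hc
  set Kq : ℝ := |Real.log (q / Real.pi)| / 2 with hKq
  have hKq0 : 0 ≤ Kq := by positivity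
  refine ⟨⌈(c + 5) ^ 2⌉₊, (9 + 2 * Kq) * (1 + Real.exp 1), fun n hn T₁ T₂ hT₁ hT₁₂ hT₂ ↦ ?_⟩
  have hc5 : (c + 5) ^ 2 ≤ (n : ℝ) := (Nat.le_ceil _).trans (by exact_mod_cast hn)
  set s := Real.sqrt n with hs
  have hn0 : (0 : ℝ) ≤ n := by positivity
  have hss : s ^ 2 = n := by rw [hs, Real.sq_sqrt hn0]
  have hs6 : c + 5 ≤ s := by
    rw [hs, ← Real.sqrt_sq (by linarith : 0 ≤ c + 5)]; exact Real.sqrt_le_sqrt hc5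
  have hs1 : 1 ≤ s := by linarith
  have hT₁1 : 1 ≤ T₁ := hs1.trans hT₁
  have hT₁0 : 0 < T₁ := by linarith
  have hn1 : (n : ℝ) ≤ T₁ ^ 2 := by rw [← hss]; exact pow_le_pow_left₀ (by linarith) hT₁ 2
  have hn2 : (n : ℝ) ≤ T₂ ^ 2 := hn1.trans (pow_le_pow_left₀ hT₁0.le hT₁₂.le 2)
  have htop : T₂ + 4 ≤ n := by
    have : (c + 5) * s ≤ s * s := mul_le_mul_of_nonneg_right hs6 (by linarith)
    nlinarith
  have hn36 : (36 : ℝ) ≤ n := by nlinarith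
  have hlogn1 : 1 ≤ Real.log n := by
    rw [Real.le_log_iff_exp_le (by linarith)]
    have := Real.exp_one_lt_d9; linarith
  have hl2 : Real.log (T₂ + 4) ≤ Real.log n := Real.log_le_log (by linarith) htop
  have hl1 : Real.log (T₁ + 4) ≤ Real.log n := Real.log_le_log (by linarith) (by linarith)
  rw [gammaEdgeIm_sub_smoothOdd_eq χ n hT₁0 hT₁₂.le, abs_mul, abs_neg,
    abs_of_pos (by positivity : (0 : ℝ) < 1 / Real.pi)]
  have htop' := norm_integral_connector_le χ n (by linarith : (1 : ℝ) ≤ T₂) hn2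
  have hbot' := norm_integral_connector_le χ n hT₁1 hn1
  rw [← hKq] at htop' hbot'
  have hre := Complex.abs_re_le_norm
    ((∫ x in (1 / 2 : ℝ)..(3 / 2 : ℝ), gammaIntegrandIm χ n (x + T₂ * I)) -
      ∫ x in (1 / 2 : ℝ)..(3 / 2 : ℝ), gammaIntegrandIm χ n (x + T₁ * I))
  have hdiff := (hre.trans (norm_sub_le _ _)).trans (add_le_add htop' hbot')
  have hπ : 1 / Real.pi ≤ 1 := by rw [div_le_one Real.pi_pos]; linarith [Real.pi_gt_three]
  have he := Real.exp_pos 1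
  have hsum : (Real.log (T₂ + 4) / 2 + 4 + Kq) * (1 + Real.exp 1) + (Real.log (T₁ + 4) / 2 + 4 + Kq) * (1 + Real.exp 1)
      ≤ (9 + 2 * Kq) * (1 + Real.exp 1) * Real.log n := by
    have h1 : Real.log (T₂ + 4) / 2 + 4 + Kq + (Real.log (T₁ + 4) / 2 + 4 + Kq) ≤ (9 + 2 * Kq) * Real.log n := by
      nlinarith
    have e : (Real.log (T₂ + 4) / 2 + 4 + Kq) * (1 + Real.exp 1) + (Real.log (T₁ + 4) / 2 + 4 + Kq) * (1 + Real.exp 1)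
        = (Real.log (T₂ + 4) / 2 + 4 + Kq + (Real.log (T₁ + 4) / 2 + 4 + Kq)) * (1 + Real.exp 1) := by ring
    rw [e, mul_assoc, mul_comm (1 + Real.exp 1) (Real.log n), ← mul_assoc]
    exact mul_le_mul_of_nonneg_right h1 (by linarith)
  calc 1 / Real.pi * |((∫ x in (1 / 2 : ℝ)..(3 / 2 : ℝ), gammaIntegrandIm χ n (x + T₂ * I)) -
          ∫ x in (1 / 2 : ℝ)..(3 / 2 : ℝ), gammaIntegrandIm χ n (x + T₁ * I)).re|
      ≤ 1 * ((Real.log (T₂ + 4) / 2 + 4 + Kq) * (1 + Real.exp 1)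
          + (Real.log (T₁ + 4) / 2 + 4 + Kq) * (1 + Real.exp 1)) :=
        mul_le_mul hπ hdiff (abs_nonneg _) zero_le_one
    _ ≤ (9 + 2 * Kq) * (1 + Real.exp 1) * Real.log n := by rw [one_mul]; exact hsum

end Summit.RiemannHypothesis.RiemannHypothesis.Theorems.LiTheory

end
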